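import Mathlib
import HarnessLib
import Literature.Analysis.FluidPDE.SlabSuitableCompactness

/-!
# Blow-up at a local Type I singular point (Albritton–Barker 2019, Thm. 1.1, forward direction;
# Seregin–Šverák 2009, Thm. 2.8), file 3:
# compactness of suitable weak solutions defined on growing balls — one subsequence at all levels

Analysis/FluidPDE proof file (theorems only: no definition, no named fact, no `sorry`).  PORT NOTE: this
module is the Literature twin of the Summits-side file
`Summits/NavierStokesRegularity/NavierStokesRegularity/Theorems/HardyPointSinkABForwardHardyCompactnessLevels.lean` (prover
seats of route HardyPointSink, landed 2026-08-16, kernel-checked), carried over verbatim up to the namespace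
(`Literature.Analysis.FluidPDE.LocalTypeIBlowup`, topic-aligned) and the provenance tags, so that the Literature named
facts `Literature.Analysis.FluidPDE.AlbrittonBarkerForward` (`LocalTypeICharacterization.lean`) and
`Literature.Analysis.FluidPDE.AlbrittonBarkerTypeICharacterization` (`LocalTypeI.lean`) are discharged INSIDE
`Literature/` (`AlbrittonBarkerForwardHolds.lean`), where `LocalTypeICharacterizationHolds.lean` asks for them; the
Summits copies are the dedup candidates of record (librarian pattern (b), promote request filed 2026-08-26).
The mathematics is the published blow-up procedure at a local Type I singular point (Seregin–Šverák 2009, §2 and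
Thm. 2.8; Albritton–Barker 2019, Prop. 2.4 and §3); nothing here is a claim about Navier–Stokes regularity.

Third helper file for the forward direction of Albritton–Barker 2019, Thm. 1.1 (blow-up at a
Type I singular point).  The tree's `slab_suitableCompactness` (`SlabSuitableCompactness.lean`;
Albritton–Barker 2019, Lemma 2.2 after Lin 1998 on the expanding balls `Q(0, 2ᵐ)`, Seregin
2014, Prop. 6.20) asks every approximant to be a suitable weak solution in **every** ball
`Q(0, 2ᵐ)`.  The rescaled solutions of a blow-up sequence at a local singularity are only
defined on growing balls: the `k`-th one on `Q(0, 2ᵏ)`, say.  This file records the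
**tail-tolerant** version of the same two theorems, with the same proofs: at level `m` only the
approximants `k ≥ m` are required to be suitable in `Q(0, 2ᵐ)` with a uniform
`L³ × L^{3/2}` bound (`local_suitableCompactness_levels`, `local_suitableCompactness`).  The
only changes to the tree proofs are index shifts by `m` (resp. `m + 1`) before the compactness
theorem on the unit ball and before the uniqueness of strong `L³` limits are invoked.

## References

* D. Albritton, T. Barker, J. Math. Fluid Mech. 21 (2019) = arXiv:1811.00502, Lemma 2.2, §3.
* F.-H. Lin, Comm. Pure Appl. Math. 51 (1998), Thm. 2.2.
* G. Seregin, *Lecture Notes on Regularity Theory for the Navier–Stokes Equations* (2014),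
  §6.6, Prop. 6.20.
-/

noncomputable section

open MeasureTheory Set Function Filter Topology TopologicalSpace Metric
open scoped NNReal ENNReal
open Literature.Analysis Literature.Analysis.FluidPDE

namespace Literature.Analysis.FluidPDE.LocalTypeIBlowup

section LocalCompactness

variable {v : ℕ → ℝ → EuclideanSpace ℝ (Fin 3) → EuclideanSpace ℝ (Fin 3)}
  {q : ℕ → ℝ → EuclideanSpace ℝ (Fin 3) → ℝ}

/-- **One subsequence at all levels.**  If `(v_k, q_k)` are suitable weak solutions in every
ball `Q(0, 2ᵐ)` with a uniform `L³ × L^{3/2}` bound on each of them, there is one strictly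
increasing `σ` such that for every level `m` the zoom-outs `2ᵐ v_{σ j}(4ᵐ s, 2ᵐ y)`,
`4ᵐ q_{σ j}(4ᵐ s, 2ᵐ y)` converge on the balls `Q(0, R)`, `R < 1`, as in A–B Lemma 2.2 to a pair
`(u_m, p_m)` which is suitable in every such ball (`SuitableCompactness_holds` at each level and
the diagonal procedure `FunctionSpaces.exists_strictMono_forall_of_extraction`).
[cite: AlbrittonBarker2019, Lemma 2.2] -/
theorem local_suitableCompactness_levels
    (hball : ∀ (m k : ℕ), m ≤ k → IsSuitableWeakSolutionInBall ((2 : ℝ) ^ m) 0 (v k) (q k))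
    (hbd : ∀ m : ℕ, (⨆ k, ⨆ (_ : m ≤ k), (eLpNorm (uncurry (v k)) 3
        (volume.restrict (parabolicCylinder ((2 : ℝ) ^ m) (0 : ℝ × EuclideanSpace ℝ (Fin 3)))) +
      eLpNorm (uncurry (q k)) (3 / 2)
        (volume.restrict (parabolicCylinder ((2 : ℝ) ^ m) (0 : ℝ × EuclideanSpace ℝ (Fin 3)))))) < ∞) :
    ∃ σ : ℕ → ℕ, StrictMono σ ∧ ∀ m : ℕ,
      ∃ (u : ℝ → EuclideanSpace ℝ (Fin 3) → EuclideanSpace ℝ (Fin 3))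
        (p : ℝ → EuclideanSpace ℝ (Fin 3) → ℝ), ∀ R ∈ Ioo (0 : ℝ) 1,
        IsSuitableWeakSolutionInBall R 0 u p ∧
        MemLp (uncurry u) 3
          (volume.restrict (parabolicCylinder R (0 : ℝ × EuclideanSpace ℝ (Fin 3)))) ∧
        Tendsto (fun j => eLpNorm
            (uncurry (((2 : ℝ) ^ m) • stPull (((2 : ℝ) ^ m) ^ 2) ((2 : ℝ) ^ m) (0 : ℝ)
              (0 : EuclideanSpace ℝ (Fin 3)) (v (σ j))) - uncurry u) 3
            (volume.restrict (parabolicCylinder R (0 : ℝ × EuclideanSpace ℝ (Fin 3)))))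
          atTop (𝓝 0) ∧
        ∀ g : ℝ × EuclideanSpace ℝ (Fin 3) → ℝ,
          MemLp g 3 (volume.restrict (parabolicCylinder R (0 : ℝ × EuclideanSpace ℝ (Fin 3)))) →
          Tendsto (fun j => ∫ w in parabolicCylinder R (0 : ℝ × EuclideanSpace ℝ (Fin 3)),
              (((2 : ℝ) ^ m) ^ 2 • stPull (((2 : ℝ) ^ m) ^ 2) ((2 : ℝ) ^ m) (0 : ℝ)
                (0 : EuclideanSpace ℝ (Fin 3)) (q (σ j))) w.1 w.2 * g w)
            atTop (𝓝 (∫ w in parabolicCylinder R (0 : ℝ × EuclideanSpace ℝ (Fin 3)),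
              p w.1 w.2 * g w)) := by
  classical
  -- ## abbreviations
  set cc : ℕ → ℝ := fun m => (2 : ℝ) ^ m with hcc
  have hcc_pos : ∀ m, 0 < cc m := fun m => by positivity
  set Vz : ℕ → ℕ → ℝ → EuclideanSpace ℝ (Fin 3) → EuclideanSpace ℝ (Fin 3) :=
    fun m k => cc m • stPull (cc m ^ 2) (cc m) (0 : ℝ) (0 : EuclideanSpace ℝ (Fin 3)) (v k) with hVz
  set Qz : ℕ → ℕ → ℝ → EuclideanSpace ℝ (Fin 3) → ℝ :=
    fun m k => cc m ^ 2 • stPull (cc m ^ 2) (cc m) (0 : ℝ) (0 : EuclideanSpace ℝ (Fin 3)) (q k) with hQz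
  set μ : ℝ → Measure (ℝ × EuclideanSpace ℝ (Fin 3)) :=
    fun R => volume.restrict (parabolicCylinder R (0 : ℝ × EuclideanSpace ℝ (Fin 3))) with hμ
  set Good : ℕ → (ℕ → ℕ) →
      ((ℝ → EuclideanSpace ℝ (Fin 3) → EuclideanSpace ℝ (Fin 3)) ×
        (ℝ → EuclideanSpace ℝ (Fin 3) → ℝ)) → Prop :=
    fun m ρ d => ∀ R ∈ Ioo (0 : ℝ) 1,
      IsSuitableWeakSolutionInBall R 0 d.1 d.2 ∧ MemLp (uncurry d.1) 3 (μ R) ∧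
      Tendsto (fun j => eLpNorm (uncurry (Vz m (ρ j)) - uncurry d.1) 3 (μ R)) atTop (𝓝 0) ∧
      ∀ g : ℝ × EuclideanSpace ℝ (Fin 3) → ℝ, MemLp g 3 (μ R) →
        Tendsto (fun j => ∫ w in parabolicCylinder R (0 : ℝ × EuclideanSpace ℝ (Fin 3)),
            (Qz m (ρ j)) w.1 w.2 * g w) atTop
          (𝓝 (∫ w in parabolicCylinder R (0 : ℝ × EuclideanSpace ℝ (Fin 3)), d.2 w.1 w.2 * g w))
    with hGood
  -- ## goodness is stable under eventual subsequences
  have hsub : ∀ m (φ φ' : ℕ → ℕ), (∃ τ : ℕ → ℕ, StrictMono τ ∧ ∀ᶠ k in atTop, φ' k = φ (τ k)) →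
      (∃ d, Good m φ d) → ∃ d, Good m φ' d := by
    rintro m φ φ' ⟨τ, hτ, heq⟩ ⟨d, hg⟩
    refine ⟨d, fun R hR => ?_⟩
    obtain ⟨h1, h2, h3, h4⟩ := hg R hR
    exact ⟨h1, h2, FunctionSpaces.tendsto_of_eventually_eq_comp
        (a := fun k => eLpNorm (uncurry (Vz m k) - uncurry d.1) 3 (μ R)) hτ heq h3,
      fun g hg' => FunctionSpaces.tendsto_of_eventually_eq_comp
        (a := fun k => ∫ w in parabolicCylinder R (0 : ℝ × EuclideanSpace ℝ (Fin 3)),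
          (Qz m k) w.1 w.2 * g w) hτ heq (h4 g hg')⟩
  -- ## extraction at one level (the compactness theorem on the unit ball)
  have hex : ∀ m (φ : ℕ → ℕ), StrictMono φ → ∃ ψ : ℕ → ℕ, StrictMono ψ ∧ ∃ d, Good m (φ ∘ ψ) d := by
    intro m φ hφ
    have hone : cc m / cc m = 1 := div_self (hcc_pos m).ne'
    -- the tail `k ↦ φ (k + m)` has `φ (k + m) ≥ m`
    have hφm : ∀ k, m ≤ φ (k + m) := fun k => (Nat.le_add_left m k).trans (hφ.id_le (k + m))
    have hsuit : ∀ k, IsSuitableWeakSolutionInBall 1 0 (Vz m (φ (k + m))) (Qz m (φ (k + m))) := by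
      intro k
      have h := (hball m (φ (k + m)) (hφm k)).zoomOut (hcc_pos m)
      rwa [hone] at h
    -- the uniform bound on the unit ball
    set K₁ : ℝ≥0∞ := ‖cc m‖ₑ *
      (ENNReal.ofReal (cc m ^ 2 * cc m ^ 3)⁻¹) ^ (1 / (3 : ℝ≥0∞).toReal) with hK₁
    set K₂ : ℝ≥0∞ := ‖cc m ^ 2‖ₑ *
      (ENNReal.ofReal (cc m ^ 2 * cc m ^ 3)⁻¹) ^ (1 / (3 / 2 : ℝ≥0∞).toReal) with hK₂
    have hK₁top : K₁ ≠ ∞ := ENNReal.mul_ne_top enorm_ne_top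
      (ENNReal.rpow_ne_top_of_nonneg (by positivity) ENNReal.ofReal_ne_top)
    have hK₂top : K₂ ≠ ∞ := ENNReal.mul_ne_top enorm_ne_top
      (ENNReal.rpow_ne_top_of_nonneg (by positivity) ENNReal.ofReal_ne_top)
    set S : ℝ≥0∞ := ⨆ k, ⨆ (_ : m ≤ k), (eLpNorm (uncurry (v k)) 3 (μ (cc m)) +
      eLpNorm (uncurry (q k)) (3 / 2) (μ (cc m))) with hS
    have hStop : S ≠ ∞ := (hbd m).ne
    have hbound : (⨆ k, eLpNorm (uncurry (Vz m (φ (k + m)))) 3 (μ 1) +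
        eLpNorm (uncurry (Qz m (φ (k + m)))) (3 / 2) (μ 1)) < ∞ := by
      refine lt_of_le_of_lt (iSup_le fun k => ?_) (ENNReal.mul_lt_top
        (ENNReal.add_lt_top.2 ⟨hK₁top.lt_top, hK₂top.lt_top⟩) hStop.lt_top)
      have hle : eLpNorm (uncurry (v (φ (k + m)))) 3 (μ (cc m)) +
          eLpNorm (uncurry (q (φ (k + m)))) (3 / 2) (μ (cc m)) ≤ S :=
        le_iSup₂ (f := fun k (_ : m ≤ k) => eLpNorm (uncurry (v k)) 3 (μ (cc m)) +
          eLpNorm (uncurry (q k)) (3 / 2) (μ (cc m))) (φ (k + m)) (hφm k)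
      have e1 : eLpNorm (uncurry (Vz m (φ (k + m)))) 3 (μ 1) =
          K₁ * eLpNorm (uncurry (v (φ (k + m)))) 3 (μ (cc m)) := by
        show eLpNorm _ 3 (volume.restrict (parabolicCylinder 1 0)) = _
        rw [← hone]
        exact eLpNorm_uncurry_zoom (hcc_pos m) (cc m) (v (φ (k + m))) (cc m) (by norm_num)
          (by norm_num)
      have e2 : eLpNorm (uncurry (Qz m (φ (k + m)))) (3 / 2) (μ 1) =
          K₂ * eLpNorm (uncurry (q (φ (k + m)))) (3 / 2) (μ (cc m)) := by
        show eLpNorm _ (3 / 2) (volume.restrict (parabolicCylinder 1 0)) = _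
        rw [← hone]
        exact eLpNorm_uncurry_zoom (hcc_pos m) (cc m ^ 2) (q (φ (k + m))) (cc m) (by norm_num)
          (ENNReal.div_ne_top (by norm_num) (by norm_num))
      rw [e1, e2]
      calc K₁ * eLpNorm (uncurry (v (φ (k + m)))) 3 (μ (cc m)) +
            K₂ * eLpNorm (uncurry (q (φ (k + m)))) (3 / 2) (μ (cc m))
          ≤ (K₁ + K₂) * eLpNorm (uncurry (v (φ (k + m)))) 3 (μ (cc m)) +
            (K₁ + K₂) * eLpNorm (uncurry (q (φ (k + m)))) (3 / 2) (μ (cc m)) := by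
            gcongr <;> simp
        _ = (K₁ + K₂) * (eLpNorm (uncurry (v (φ (k + m)))) 3 (μ (cc m)) +
            eLpNorm (uncurry (q (φ (k + m)))) (3 / 2) (μ (cc m))) := by rw [mul_add]
        _ ≤ (K₁ + K₂) * S := by gcongr
    obtain ⟨u, p, ψ, hψ, hconv⟩ :=
      SuitableCompactness_holds (fun k => Vz m (φ (k + m))) (fun k => Qz m (φ (k + m))) hsuit hbound
    refine ⟨fun k => ψ k + m, fun a b hab => Nat.add_lt_add_right (hψ hab) m, (u, p), fun R hR => ?_⟩
    exact hconv R hR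
  -- ## the diagonal
  obtain ⟨σ, hσ, hgood⟩ := FunctionSpaces.exists_strictMono_forall_of_extraction hsub hex
  refine ⟨σ, hσ, fun m => ?_⟩
  obtain ⟨⟨u, p⟩, hd⟩ := hgood m
  exact ⟨u, p, fun R hR => hd R hR⟩

end LocalCompactness

end Literature.Analysis.FluidPDE.LocalTypeIBlowup

end
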